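import Summits.BirchSwinnertonDyer.Rank1Residual.X5.KummerRelaxedStrictCount
import Summits.BirchSwinnertonDyer.Rank1Residual.X11b.BDPRouteSelmerLevelBound
import Mathlib.NumberTheory.Padics.HeightOneSpectrum
import HarnessLib

/-!
# HT-C6 (B2 Tamagawa splitting), tool file 3/5: the Selmer group of the transported dual `w⁻¹(Kum^{v ↦ L})^*` is no
# bigger than that of `Kum^{v ↦ L}` once `#L ≥ n` (one-place Poitou–Tate count + Kummer self-duality off `v`), and small
# bookkeeping (crux `SupersingularRankZeroAtTwo` = stmt-BirchSwinnertonDyer-19097, line `odd_blind_package`, slot 5 CDC_H, glue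
# binder hB2; cell `bsd-2adic`, seat `bsd-2adic-t42` GEN 41)

THEOREMS ONLY (no definition, no named fact, no instance, no `sorry`); `--supports stmt-BirchSwinnertonDyer-19097 --as helper`;
route-free imports; closes nothing; BSD is proved for no curve. CONDITIONAL exactly as its inputs (`X11b.PoitouTateCounting`,
`X5.SelfDualCount`): on a family `inv` of local invariant maps with `IsPerfect`, `SumLocalTermEqZero`, `SelmerComplement` (hypotheses).

* `eq_of_natCast_mem_asIdeal`, `coe_primesEquiv_eq_of_natCast_mem` (the place of `ℚ` above a rational prime), `selmerGroup_mono`, `finite_selmerGroup_of_eq_kummer_off` (a structure that is Kummer off a finite `S` has a finite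
  Selmer group, inside `kummerOutside W n S`).
* ★ `natCard_selmerGroup_dualTransported_update_le` — for `𝓛 = Kum^{v ↦ L}` on `E[n]` over `ℚ` with Kummer self-dual off `v`,
  `#H¹(ℚ_v, E[n]) = n²`, `[Kum^{v↦⊤} : Kum^{v↦⊥}] = n` and `n ≤ #L`: **`#H¹_{w⁻¹𝓛^*} ≤ #H¹_𝓛`** — Howard's one-place count
  `[Kum^{v↦⊤} : 𝓛] · [w⁻¹𝓛^* : Kum^{v↦⊥}] = [H¹(ℚ_v) : L]` (tree `X11b.PoitouTateCounting.relIndex_selmerGroup_mul_relIndex_dual_eq`) read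
  through Sakamoto's Weil transport (`X5.SelfDualCount.dualSelmerGroup_eq_map_selmerGroup_dualTransported`, `dualTransported_update_top`):
  `#H¹_{w⁻¹𝓛^*} · #L = n · #H¹_𝓛`, the finite-level shape of Wiles' formula for this structure.

References: [MilneADT2006] I Thm. 4.10, Lemma 3.3, Cor. 2.3; [Howard2004HeegnerKolyvagin] Thm. 2.1.11; [Sakamoto2024] §3.1.2;
[GreenbergLNM1716] §4 pp. 122–124.
-/

set_option autoImplicit false
set_option linter.dupNamespace false

noncomputable section

open scoped Classical NumberField AddSubgroup ContRepresentation

namespace Summit.BirchSwinnertonDyer.BirchSwinnertonDyer.Theorems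

namespace FlatBlindTamagawaSplitting

open NumberField IsDedekindDomain Field Function WeierstrassCurve Literature.NumberTheory.EllipticCurves
  Literature.NumberTheory.GaloisRepresentations Literature.NumberTheory.GaloisCohomology
open Literature.NumberTheory.GaloisRepresentations.DiscreteGaloisModule (SelmerStructure)
open Summit.BirchSwinnertonDyer.Rank1Residual.X11b Summit.BirchSwinnertonDyer.Rank1Residual.X11b.KummerPT
  Summit.BirchSwinnertonDyer.Rank1Residual.X11b.LocBridge Summit.BirchSwinnertonDyer.Rank1Residual.X5

/-! ## §1 Small bookkeeping -/

/-- The rational prime below a finite place `v ∋ p` of `ℚ` is `p` (`primesEquiv v = p`). [folklore] -/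
theorem coe_primesEquiv_eq_of_natCast_mem {p : ℕ} [hp : Fact p.Prime] {v : HeightOneSpectrum (𝓞 ℚ)}
    (hpv : (p : 𝓞 ℚ) ∈ v.asIdeal) : ((Rat.HeightOneSpectrum.primesEquiv v : Nat.Primes) : ℕ) = p := by
  have h : Rat.HeightOneSpectrum.natGenerator v ∣ p := by
    rw [Rat.HeightOneSpectrum.natGenerator_dvd_iff, ← map_natCast (Rat.IsIntegralClosure.intEquiv (𝓞 ℚ)) p]
    exact Ideal.mem_map_of_mem _ hpv
  exact (Nat.prime_dvd_prime_iff_eq (Rat.HeightOneSpectrum.prime_natGenerator v) hp.out).mp h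

/-- A finite place of `ℚ` containing the rational prime `p` is determined by it (`primesEquiv` is a bijection). [folklore] -/
theorem eq_of_natCast_mem_asIdeal {p : ℕ} [hp : Fact p.Prime] {v ℓ : HeightOneSpectrum (𝓞 ℚ)}
    (hv : (p : 𝓞 ℚ) ∈ v.asIdeal) (hℓ : (p : 𝓞 ℚ) ∈ ℓ.asIdeal) : ℓ = v :=
  (Rat.HeightOneSpectrum.primesEquiv (R := 𝓞 ℚ)).injective
    (Subtype.ext ((coe_primesEquiv_eq_of_natCast_mem hℓ).trans (coe_primesEquiv_eq_of_natCast_mem hv).symm))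

/-- Monotonicity of Selmer groups in the Selmer structure. [cite: Howard2004HeegnerKolyvagin, Thm. 2.1.11 (arXiv:1202.6340 p. 6)] -/
theorem selmerGroup_mono {K : Type} [Field K] [NumberField K] {M : Type} [AddCommGroup M] [TopologicalSpace M]
    [DiscreteTopology M] {ρ : DiscreteGaloisModule K M} {𝓕 𝓖 : SelmerStructure ρ} (h : 𝓕 ≤ 𝓖) :
    𝓕.selmerGroup ≤ 𝓖.selmerGroup := fun _ hx ↦
  (SelmerStructure.mem_selmerGroup_iff _ _).2 fun u ↦ h u ((SelmerStructure.mem_selmerGroup_iff _ _).1 hx u)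

/-- A Selmer structure on `E[n]` that is the Kummer condition off a finite set `S` has a FINITE Selmer group (it lies in
`kummerOutside W n S = H¹_{Kum^{S ↦ ⊤}}`, finite by X11b `SelmerLevelBound.finite_kummerOutside`). [cite: MilneADT2006, Ch. I, Lemma 6.15] -/
theorem finite_selmerGroup_of_eq_kummer_off {K : Type} [Field K] [NumberField K] (W : WeierstrassCurve K) [W.IsElliptic]
    (n : ℕ) [NeZero n] (S : Finset (Place K)) (𝓕 : SelmerStructure (W.torsionGaloisModule (n : ℤ)))
    (h : ∀ u ∉ S, 𝓕 u = W.kummerSelmerStructure (n : ℤ) u) : Finite 𝓕.selmerGroup := by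
  haveI := SelmerLevelBound.finite_kummerOutside W n S
  have hK : 𝓕.selmerGroup ≤ kummerOutside W n S := by
    rw [← selmerGroup_kummerRelaxed W n S]
    refine selmerGroup_mono fun u ↦ ?_
    by_cases hu : u ∈ S
    · rw [kummerRelaxed_of_mem W n S hu]; exact le_top
    · rw [kummerRelaxed_of_not_mem W n S hu, h u hu]
  exact Finite.of_injective (fun x : 𝓕.selmerGroup ↦ (⟨x.1, hK x.2⟩ : kummerOutside W n S))
    fun x y hxy ↦ Subtype.ext (congrArg (fun z : kummerOutside W n S ↦ (z : galoisCohomology (W.torsionGaloisModule (n : ℤ)) 1)) hxy)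

/-! ## §2 The transported dual of `Kum^{v ↦ L}` -/

/-- **The transported dual of `Kum^{v ↦ L}` has a Selmer group no bigger than `Kum^{v ↦ L}` itself, once `#L ≥ n`**
(`#H¹(ℚ_v, W[n]) = n²`, `[Kum^{v↦⊤} : Kum^{v↦⊥}] = n`, Kummer self-dual off `v`): the ONE-PLACE Poitou–Tate count
(`X11b.PoitouTateCounting.relIndex_selmerGroup_mul_relIndex_dual_eq`, Howard 2.1.11) for the pair `Kum^{v↦L} ≤ Kum^{v↦⊤}`, whose dual
pair is `Kum^{v↦⊥} ≤ w⁻¹(Kum^{v↦L})^*` after Sakamoto's Weil transport (`X5.SelfDualCount`), reads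
`[Kum^{v↦⊤} : Kum^{v↦L}] · [w⁻¹(Kum^{v↦L})^* : Kum^{v↦⊥}] = [H¹(ℚ_v) : L]`, i.e. `#w⁻¹(Kum^{v↦L})^* · #L = n · #Kum^{v↦L}`
— the finite-level form of Wiles' formula `#H¹_𝓕/#H¹_{𝓕^*} = ∏_u #𝓕_u/#H⁰(ℚ_u)` for this structure.
[cite: MilneADT2006, Ch. I, Thm. 4.10 and Lemma 3.3] [cite: Howard2004HeegnerKolyvagin, Thm. 2.1.11 (arXiv:1202.6340 p. 6)]
[cite: Sakamoto2024, §3.1.2 (p. 924)] -/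
theorem natCard_selmerGroup_dualTransported_update_le (W : WeierstrassCurve ℚ) [W.IsElliptic] (n : ℕ) [NeZero n]
    [Finite (W.geomTorsion (n : ℤ))] (e : W.geomTorsion n → W.geomTorsion n → AlgebraicClosure ℚ) (hμ : ∀ S T, e S T ^ n = 1)
    (hadd₁ : ∀ S₁ S₂ T, e (S₁ + S₂) T = e S₁ T * e S₂ T) (hadd₂ : ∀ S T₁ T₂, e S (T₁ + T₂) = e S T₁ * e S T₂)
    (hgal : ∀ (σ : absoluteGaloisGroup ℚ) (S T : W.geomTorsion n), σ • e S T = e (σ • S) (σ • T))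
    (hnondeg : ∀ T, (∀ S, e S T = 1) → T = 0) (inv : LocalInvariants ℚ n)
    (hperf : inv.IsPerfect) (hvan : inv.SumLocalTermEqZero) (hcomp : inv.SelmerComplement)
    {S : Finset (Place ℚ)} (hS : ∀ u : HeightOneSpectrum (𝓞 ℚ), (Sum.inr u : Place ℚ) ∉ S →
      ((n : ℕ) : 𝓞 ℚ) ∉ u.asIdeal ∧ GaloisRep.IsUnramifiedAt u (W.torsionGaloisModule n))
    (hKumUnr : SelmerStructure.IsUnramifiedOutside (W.kummerSelmerStructure (n : ℤ)) S)
    {v : HeightOneSpectrum (𝓞 ℚ)} (hvS : (Sum.inr v : Place ℚ) ∈ S)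
    (L : AddSubgroup (galoisCohomology ((W.torsionGaloisModule (n : ℤ)).toLocal (Sum.inr v)) 1))
    (hsd : ∀ u : Place ℚ, u ≠ Sum.inr v →
      inv.dualTransported (W.kummerSelmerStructure (n : ℤ)) (weilDualIntertwining W n e hμ hadd₁ hadd₂ hgal) u =
        W.kummerSelmerStructure (n : ℤ) u)
    (hA : Nat.card (galoisCohomology ((W.torsionGaloisModule (n : ℤ)).toLocal (Sum.inr v)) 1) = n * n)
    (hRS : (SelmerStructure.selmerGroup (Function.update (W.kummerSelmerStructure (n : ℤ)) (Sum.inr v) ⊥ :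
        SelmerStructure (W.torsionGaloisModule (n : ℤ)))).relIndex
      (SelmerStructure.selmerGroup (Function.update (W.kummerSelmerStructure (n : ℤ)) (Sum.inr v) ⊤ :
        SelmerStructure (W.torsionGaloisModule (n : ℤ)))) = n)
    (hL : n ≤ Nat.card L) :
    Nat.card (inv.dualTransported (Function.update (W.kummerSelmerStructure (n : ℤ)) (Sum.inr v) L)
        (weilDualIntertwining W n e hμ hadd₁ hadd₂ hgal)).selmerGroup ≤
      Nat.card (SelmerStructure.selmerGroup (Function.update (W.kummerSelmerStructure (n : ℤ)) (Sum.inr v) L :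
        SelmerStructure (W.torsionGaloisModule (n : ℤ)))) := by
  set Kum := W.kummerSelmerStructure (n : ℤ) with hKum
  set θ := weilDualIntertwining W n e hμ hadd₁ hadd₂ hgal with hθ
  set 𝓛 : SelmerStructure (W.torsionGaloisModule (n : ℤ)) := Function.update Kum (Sum.inr v) L with h𝓛
  set R : SelmerStructure (W.torsionGaloisModule (n : ℤ)) := Function.update Kum (Sum.inr v) ⊤ with hR
  set S0 : SelmerStructure (W.torsionGaloisModule (n : ℤ)) := Function.update Kum (Sum.inr v) ⊥ with hS0
  have hM : ∀ m : W.geomTorsion (n : ℤ), n • m = 0 := fun m ↦ AddSubgroup.torsionBy.nsmul m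
  have hle : 𝓛 ≤ R := by
    intro u; by_cases hu : u = Sum.inr v
    · rw [hu, h𝓛, hR, Function.update_self, Function.update_self]; exact le_top
    · rw [h𝓛, hR, Function.update_of_ne hu, Function.update_of_ne hu]
  have heq : ∀ u ≠ (Sum.inr v : Place ℚ), 𝓛 u = R u := fun u hu ↦ by
    rw [h𝓛, hR, Function.update_of_ne hu, Function.update_of_ne hu]
  have h𝓛unr : 𝓛.IsUnramifiedOutside S := SelfDualCount.isUnramifiedOutside_update W n hKumUnr hvS L
  have hRunr : R.IsUnramifiedOutside S := SelfDualCount.isUnramifiedOutside_update W n hKumUnr hvS ⊤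
  -- the one-place count for `𝓛 ≤ R`
  have hcount := PoitouTateCounting.relIndex_selmerGroup_mul_relIndex_dual_eq (ρ := W.torsionGaloisModule (n : ℤ))
    (𝓕 := 𝓛) (𝓖 := R) (w₀ := v) hperf hvan hcomp hM hS hle h𝓛unr hRunr hvS heq
  -- the transported duals: `w⁻¹R^* = S0`, `w⁻¹𝓛^* = Kum^{v ↦ w⁻¹𝓛^*_v}`
  have hT𝓛off : ∀ u ≠ (Sum.inr v : Place ℚ), inv.dualTransported 𝓛 θ u = Kum u := fun u hu ↦ by
    rw [← hsd u hu]
    ext y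
    simp only [LocalInvariants.mem_dualTransported_iff, LocalInvariants.dualSelmerStructure_apply, h𝓛,
      Function.update_of_ne hu]
  have hTR : inv.dualTransported R θ = S0 := by
    have hRL : R = Function.update 𝓛 (Sum.inr v) ⊤ := by rw [h𝓛, hR, Function.update_idem]
    rw [hRL, hθ, SelfDualCount.dualTransported_update_top W n e hμ hadd₁ hadd₂ hgal hnondeg inv hperf 𝓛 v]
    funext u
    by_cases hu : u = Sum.inr v
    · rw [hu, Function.update_self, hS0, Function.update_self]
    · rw [Function.update_of_ne hu, hS0, Function.update_of_ne hu, ← hθ, hT𝓛off u hu]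
  have hdR : (inv.dualSelmerStructure (W.torsionGaloisModule (n : ℤ)) R).selmerGroup =
      S0.selmerGroup.map (galoisCohomology.map θ 1) := by
    rw [SelfDualCount.dualSelmerGroup_eq_map_selmerGroup_dualTransported W n e hμ hadd₁ hadd₂ hgal hnondeg inv R, ← hθ, hTR]
  have hd𝓛 : (inv.dualSelmerStructure (W.torsionGaloisModule (n : ℤ)) 𝓛).selmerGroup =
      (inv.dualTransported 𝓛 θ).selmerGroup.map (galoisCohomology.map θ 1) := by
    rw [SelfDualCount.dualSelmerGroup_eq_map_selmerGroup_dualTransported W n e hμ hadd₁ hadd₂ hgal hnondeg inv 𝓛, ← hθ]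
  rw [hdR, hd𝓛, AddSubgroup.relIndex_map_map_of_injective _ _
    (SelfDualCount.map_weilDual_injective W n e hμ hadd₁ hadd₂ hgal hnondeg)] at hcount
  -- the local index at `v`: `[H¹(ℚ_v) : L] · #L = n · n`
  have hv𝓛 : 𝓛 (Sum.inr v) = L := by rw [h𝓛, Function.update_self]
  have hvR : R (Sum.inr v) = ⊤ := by rw [hR, Function.update_self]
  rw [hv𝓛, hvR, AddSubgroup.relIndex_top_right] at hcount
  have hLidx : Nat.card L * L.index = n * n := by rw [AddSubgroup.card_mul_index, hA]
  -- inclusions and finiteness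
  have hS0T : S0 ≤ inv.dualTransported 𝓛 θ := by
    intro u; by_cases hu : u = Sum.inr v
    · rw [hu, hS0, Function.update_self]; exact bot_le
    · rw [hS0, Function.update_of_ne hu, hT𝓛off u hu]
  have hS0R : S0 ≤ R := by
    intro u; by_cases hu : u = Sum.inr v
    · rw [hu, hS0, hR, Function.update_self, Function.update_self]; exact bot_le
    · rw [hS0, hR, Function.update_of_ne hu, Function.update_of_ne hu]
  haveI hRfin : Finite R.selmerGroup := finite_selmerGroup_of_eq_kummer_off W n S R fun u hu ↦ by
    have hne : u ≠ Sum.inr v := fun h ↦ hu (h ▸ hvS)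
    rw [hR, Function.update_of_ne hne]
  have hrpos : 0 < Nat.card R.selmerGroup := Nat.card_pos
  -- cardinal bookkeeping (Lagrange: `#H · [K : H] = #K` for `H ≤ K`)
  have cmr : ∀ {H H' : AddSubgroup (galoisCohomology (W.torsionGaloisModule (n : ℤ)) 1)}, H ≤ H' →
      Nat.card H * H.relIndex H' = Nat.card H' := fun {H H'} h ↦ by
    rw [AddSubgroup.relIndex, ← Nat.card_congr (AddSubgroup.addSubgroupOfEquivOfLe h).toEquiv]
    exact AddSubgroup.card_mul_index _
  have E1 := cmr (selmerGroup_mono hle)          -- b * i₁ = r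
  have E2 := cmr (selmerGroup_mono hS0T)         -- s * i₂ = x
  have E4 := cmr (selmerGroup_mono hS0R)         -- s * n = r
  rw [hRS] at E4
  set b := Nat.card 𝓛.selmerGroup
  set r := Nat.card R.selmerGroup
  set s := Nat.card S0.selmerGroup
  set x := Nat.card (inv.dualTransported 𝓛 θ).selmerGroup
  set i₁ := 𝓛.selmerGroup.relIndex R.selmerGroup
  set i₂ := S0.selmerGroup.relIndex (inv.dualTransported 𝓛 θ).selmerGroup
  have hi₁ : 0 < i₁ := Nat.pos_of_ne_zero fun h ↦ by rw [h, mul_zero] at E1; exact hrpos.ne' E1.symm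
  have hnpos : 0 < n := Nat.pos_of_ne_zero (NeZero.ne n)
  -- `x · #L · i₁ = b · i₁ · n`
  have hmain : x * Nat.card L * i₁ = b * n * i₁ := by
    calc x * Nat.card L * i₁ = s * (Nat.card L * (i₁ * i₂)) := by rw [← E2]; ring
      _ = s * (n * n) := by rw [hcount, hLidx]
      _ = (s * n) * n := by ring
      _ = b * i₁ * n := by rw [E4, ← E1]
      _ = b * n * i₁ := by ring
  have hxl : x * Nat.card L = b * n := Nat.eq_of_mul_eq_mul_right hi₁ hmain
  have hxn : x * n ≤ b * n := by
    calc x * n ≤ x * Nat.card L := Nat.mul_le_mul_left x hL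
      _ = b * n := hxl
  exact Nat.le_of_mul_le_mul_right hxn hnpos


end FlatBlindTamagawaSplitting

end Summit.BirchSwinnertonDyer.BirchSwinnertonDyer.Theorems

end
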